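import Literature.Analysis.FluidPDE.OseenSlice
import Literature.Analysis.FluidPDE.KochTataruKernelFourier
import Literature.Analysis.FluidPDE.PeriodicBoundedMildMean
import Literature.Analysis.FunctionSpaces.TorusKernelApproximation
import HarnessLib

/-!
# Fourier coefficients of the Oseen slice of periodic fields

Analysis/FluidPDE support file (everything proved) for the perturbation step of M. P. Coiculescu,
S. Palasek, *Non-uniqueness of smooth solutions of the Navier–Stokes equations from critical data*,
Invent. Math. 244 (2025) = arXiv:2503.14699, Prop. 4.3 ("`w⁽ⁱ⁾(t) → 0`" as `t → 0` in a negative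
norm) and §5 (both solutions attain the same datum): in the tree's rendering the correction
`w(t)` must tend to `0` in `Ḣ⁻¹(𝕋³)`, and `w(t)` is a sum of Duhamel terms
`∫₀ᵗ N_{t-τ}[a(τ), b(τ)] dτ`, `N_σ[a,b] = e^{σΔ}ℙ∇·(a ⊗ b)` (`oseenSlice`), of periodic fields. The
`Ḣ⁻¹` norm is spectral, so one needs the torus Fourier coefficients of `x ↦ N_σ[ã, b̃](repr x)`
for lifts `ã = lift A`, `b̃ = lift B`:

* `inner_oseenKernel_eq_sum_single` — bilinear expansion of `⟪K(σ,z)[a,b], w⟫` along the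
  standard basis;
* `Torus.inner_oseenSlice_lift_repr_eq_sum` —
  `⟪N_σ[ã,b̃](repr x), w⟫ = Σⱼₗ ∫ κⱼₗ(z) (Aⱼ Bₗ)(x - proj z) dz`, `κⱼₗ(z) = ⟪K(σ,z)[eⱼ,eₗ], w⟫`;
* `Torus.mFourierCoeff_inner_oseenSlice_lift_repr` — hence, by the multiplier identity
  `Torus.mFourierCoeff_ofReal_integral_kernel_smul`,
  `𝓕_𝕋(⟪N_σ[ã,b̃]∘repr, w⟫)(k) = Σⱼₗ 𝓕κⱼₗ(k) · 𝓕_𝕋(Aⱼ Bₗ)(k)`;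
* `norm_fourier_inner_oseenKernel_le` — Koch–Tataru's symbol (their (6)–(8)):
  `|𝓕κ(ξ)| ≤ 2π |ξ| ‖a‖ ‖b‖ ‖w‖` (no singularity in `σ`);
* `Torus.norm_mFourierCoeff_inner_oseenSlice_lift_repr_le` —
  `|𝓕_𝕋(⟪N_σ[ã,b̃]∘repr, w⟫)(k)| ≤ 2π |k| ‖w‖ Σⱼₗ |𝓕_𝕋(AⱼBₗ)(k)|`.

## References

* H. Koch, D. Tataru, *Well-posedness for the Navier–Stokes equations*, Adv. Math. 157 (2001),
  §2 (6)–(8) (the symbol of the Oseen kernel). [`KochTataruAdvMath2001`]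
* M. P. Coiculescu, S. Palasek, Invent. Math. 244 (2025) = arXiv:2503.14699, Prop. 4.3, §5.
  [`CoiculescuPalasek2025`]
-/

noncomputable section

open MeasureTheory Set Function Filter TopologicalSpace InnerProductSpace Metric Real UnitAddTorus
open Literature.Analysis.FunctionSpaces
open _root_.Topology
open scoped RealInnerProductSpace NNReal ENNReal FourierTransform

namespace Literature.Analysis.FluidPDE

variable {d : Type*} [Fintype d] [DecidableEq d]

/-! ### Bilinear expansion of the kernel pairing -/

/-- **Bilinear expansion of the kernel pairing along the standard basis**:
`⟪K(σ,z)[a,b], w⟫ = Σⱼ Σₗ aⱼ bₗ ⟪K(σ,z)[eⱼ,eₗ], w⟫`. [folklore] -/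
theorem inner_oseenKernel_eq_sum_single (σ : ℝ) (z a b w : EuclideanSpace ℝ d) :
    ⟪oseenKernel σ z a b, w⟫ = ∑ j, ∑ l, a j * b l *
      ⟪oseenKernel σ z (EuclideanSpace.single j (1 : ℝ)) (EuclideanSpace.single l (1 : ℝ)), w⟫ := by
  have ha : a = ∑ j, a j • EuclideanSpace.single j (1 : ℝ) := by
    conv_lhs => rw [← (EuclideanSpace.basisFun d ℝ).sum_repr a]
    simp only [EuclideanSpace.basisFun_repr, EuclideanSpace.basisFun_apply]
  have hb : b = ∑ l, b l • EuclideanSpace.single l (1 : ℝ) := by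
    conv_lhs => rw [← (EuclideanSpace.basisFun d ℝ).sum_repr b]
    simp only [EuclideanSpace.basisFun_repr, EuclideanSpace.basisFun_apply]
  have hK : oseenKernel σ z a b = ∑ j, ∑ l, (a j * b l) •
      oseenKernel σ z (EuclideanSpace.single j (1 : ℝ)) (EuclideanSpace.single l (1 : ℝ)) := by
    conv_lhs => rw [ha]
    rw [← oseenKernelCLM_apply, map_sum, _root_.sum_apply]
    refine Finset.sum_congr rfl fun j _ => ?_
    rw [map_smul, _root_.smul_apply, oseenKernelCLM_apply]
    conv_lhs => rw [hb]
    rw [← oseenKernelCLM_apply, map_sum, Finset.smul_sum]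
    refine Finset.sum_congr rfl fun l _ => ?_
    rw [map_smul, oseenKernelCLM_apply, smul_smul]
  rw [hK, sum_inner]
  refine Finset.sum_congr rfl fun j _ => ?_
  rw [sum_inner]
  refine Finset.sum_congr rfl fun l _ => ?_
  rw [real_inner_smul_left]

omit [DecidableEq d] in
/-- The kernel pairing `z ↦ ⟪K(σ,z)[a,b], w⟫` is integrable for `σ > 0` (Koch–Tataru's (14)).
[cite: KochTataruAdvMath2001, §3 (14)] -/
theorem integrable_inner_oseenKernel_real {σ : ℝ} (hσ : 0 < σ) (a b w : EuclideanSpace ℝ d) :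
    Integrable (fun z : EuclideanSpace ℝ d => ⟪oseenKernel σ z a b, w⟫) := by
  obtain ⟨_, -, hK⟩ := exists_lintegral_enorm_oseenKernel_le (E := EuclideanSpace ℝ d)
  exact (hK hσ a b).1.inner_const w

omit [DecidableEq d] in
/-- **Koch–Tataru's symbol bound**: `|𝓕(z ↦ ⟪K(σ,z)[a,b], w⟫)(ξ)| ≤ 2π |ξ| ‖a‖ ‖b‖ ‖w‖`
(`𝓕 = 2πi⟪ξ,a⟫ e^{-4π²σ|ξ|²} ⟪P(ξ)b, w⟫`, `|P(ξ)| ≤ 1`, `e^{-4π²σ|ξ|²} ≤ 1`) — uniform in `σ > 0`.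
[cite: KochTataruAdvMath2001, §2 (6)–(8)] -/
theorem norm_fourier_inner_oseenKernel_le {σ : ℝ} (hσ : 0 < σ) (a b w ξ : EuclideanSpace ℝ d) :
    ‖𝓕 (fun z : EuclideanSpace ℝ d => ((⟪oseenKernel σ z a b, w⟫ : ℝ) : ℂ)) ξ‖ ≤
      2 * π * ‖ξ‖ * ‖a‖ * ‖b‖ * ‖w‖ := by
  rw [fourier_inner_oseenKernel_eq_leraySymbol hσ a b w ξ]
  have h1 : |⟪ξ, a⟫| ≤ ‖ξ‖ * ‖a‖ := abs_real_inner_le_norm ξ a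
  have h2 : |⟪leraySymbol ξ b, w⟫| ≤ ‖b‖ * ‖w‖ :=
    (abs_real_inner_le_norm _ _).trans
      (mul_le_mul_of_nonneg_right (norm_leraySymbol_apply_le ξ b) (norm_nonneg _))
  have h3 : |UnboundedOperators.heatSymbol σ ξ| ≤ 1 := by
    rw [abs_of_pos (UnboundedOperators.heatSymbol_pos σ ξ)]
    exact UnboundedOperators.heatSymbol_le_one hσ.le ξ
  simp only [norm_mul, Complex.norm_real, Complex.norm_I, Real.norm_eq_abs, Complex.norm_ofNat,
    mul_one]
  rw [abs_of_pos Real.pi_pos]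
  calc 2 * π * |⟪ξ, a⟫| * |UnboundedOperators.heatSymbol σ ξ| * |⟪leraySymbol ξ b, w⟫|
      ≤ 2 * π * (‖ξ‖ * ‖a‖) * 1 * (‖b‖ * ‖w‖) := by gcongr
    _ = 2 * π * ‖ξ‖ * ‖a‖ * ‖b‖ * ‖w‖ := by ring

namespace Torus

/-! ### The pairing of the slice of periodic fields as a sum of kernel smoothings -/

/-- **The paired slice of periodic fields is a finite sum of kernel smoothings**: for
continuous `A, B : 𝕋ᵈ → ℝᵈ`, `σ > 0` and `w ∈ ℝᵈ`,
`⟪N_σ[lift A, lift B](repr x), w⟫ = Σⱼ Σₗ ∫ κⱼₗ(z) (Aⱼ Bₗ)(x - proj z) dz` with the integrable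
kernels `κⱼₗ(z) = ⟪K(σ,z)[eⱼ,eₗ], w⟫`. [folklore] -/
theorem inner_oseenSlice_lift_repr_eq_sum {A B : UnitAddTorus d → EuclideanSpace ℝ d}
    (hA : Continuous A) (hB : Continuous B) {σ : ℝ} (hσ : 0 < σ) (w : EuclideanSpace ℝ d)
    (x : UnitAddTorus d) :
    ⟪oseenSlice σ (Torus.lift A) (Torus.lift B) (Torus.repr x), w⟫ =
      ∑ j, ∑ l, ∫ z : EuclideanSpace ℝ d,
        ⟪oseenKernel σ z (EuclideanSpace.single j (1 : ℝ)) (EuclideanSpace.single l (1 : ℝ)), w⟫ •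
          (A (x - Torus.proj z) j * B (x - Torus.proj z) l) := by
  haveI : CompleteSpace (EuclideanSpace ℝ d) := FiniteDimensional.complete ℝ _
  obtain ⟨MA, hMA⟩ := Torus.exists_forall_norm_le_of_continuous hA
  obtain ⟨MB, hMB⟩ := Torus.exists_forall_norm_le_of_continuous hB
  -- the slice as an integral over the shift
  have hslice : oseenSlice σ (Torus.lift A) (Torus.lift B) (Torus.repr x) =
      ∫ z, oseenKernel σ z (A (x - Torus.proj z)) (B (x - Torus.proj z)) := by
    rw [oseenSlice_eq_integral_sub]
    simp_rw [lift_repr_sub]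
  have hint : Integrable (fun z => oseenKernel σ z (A (x - Torus.proj z)) (B (x - Torus.proj z))) := by
    have h := integrable_oseenKernel_slice_sub hσ
      (Torus.continuous_lift_iff.2 hA).measurable (Torus.continuous_lift_iff.2 hB).measurable
      (fun y => hMA _) (fun y => hMB _) (Torus.repr x)
    refine h.congr (Eventually.of_forall fun z => ?_)
    simp only [lift_repr_sub]
  rw [hslice, real_inner_comm, ← integral_inner hint w]
  -- expand the integrand
  have hexp : ∀ z, ⟪w, oseenKernel σ z (A (x - Torus.proj z)) (B (x - Torus.proj z))⟫ =
      ∑ j, ∑ l, ⟪oseenKernel σ z (EuclideanSpace.single j (1 : ℝ)) (EuclideanSpace.single l (1 : ℝ)), w⟫ •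
        (A (x - Torus.proj z) j * B (x - Torus.proj z) l) := by
    intro z
    rw [real_inner_comm, inner_oseenKernel_eq_sum_single]
    refine Finset.sum_congr rfl fun j _ => Finset.sum_congr rfl fun l _ => ?_
    rw [smul_eq_mul]; ring
  simp_rw [hexp]
  -- each term is integrable: integrable kernel times a bounded continuous factor
  have hterm : ∀ j l, Integrable (fun z : EuclideanSpace ℝ d =>
      ⟪oseenKernel σ z (EuclideanSpace.single j (1 : ℝ)) (EuclideanSpace.single l (1 : ℝ)), w⟫ •
        (A (x - Torus.proj z) j * B (x - Torus.proj z) l)) := by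
    intro j l
    have hc : Continuous fun z : EuclideanSpace ℝ d => A (x - Torus.proj z) j * B (x - Torus.proj z) l :=
      ((EuclideanSpace.proj j).continuous.comp (hA.comp (continuous_const.sub Torus.continuous_proj))).mul
        ((EuclideanSpace.proj l).continuous.comp (hB.comp (continuous_const.sub Torus.continuous_proj)))
    refine (integrable_inner_oseenKernel_real hσ _ _ w).smul_bdd (MA * MB) hc.aestronglyMeasurable
      (Eventually.of_forall fun z => ?_)
    rw [norm_mul]
    exact mul_le_mul ((PiLp.norm_apply_le _ j).trans (hMA _)) ((PiLp.norm_apply_le _ l).trans (hMB _))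
      (norm_nonneg _) ((norm_nonneg _).trans (hMA (x - Torus.proj z)))
  rw [integral_finsetSum _ (fun j _ => integrable_finsetSum _ (fun l _ => hterm j l))]
  exact Finset.sum_congr rfl fun j _ => integral_finsetSum _ (fun l _ => hterm j l)

/-- **The torus Fourier coefficients of the paired slice**: with `κⱼₗ(z) = ⟪K(σ,z)[eⱼ,eₗ], w⟫`,
`𝓕_𝕋(⟪N_σ[lift A, lift B] ∘ repr, w⟫)(k) = Σⱼₗ 𝓕κⱼₗ(Torus.latticeVec k) · 𝓕_𝕋(Aⱼ Bₗ)(k)` (each term by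
the multiplier identity `Torus.mFourierCoeff_ofReal_integral_kernel_smul`). [folklore] -/
theorem mFourierCoeff_inner_oseenSlice_lift_repr {A B : UnitAddTorus d → EuclideanSpace ℝ d}
    (hA : Continuous A) (hB : Continuous B) {σ : ℝ} (hσ : 0 < σ) (w : EuclideanSpace ℝ d)
    (k : d → ℤ) :
    mFourierCoeff (fun x => ((⟪oseenSlice σ (Torus.lift A) (Torus.lift B) (Torus.repr x), w⟫ : ℝ) : ℂ)) k =
      ∑ j, ∑ l, 𝓕 (fun z : EuclideanSpace ℝ d =>
          ((⟪oseenKernel σ z (EuclideanSpace.single j (1 : ℝ)) (EuclideanSpace.single l (1 : ℝ)), w⟫ : ℝ) : ℂ))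
            (Torus.latticeVec k) *
        mFourierCoeff (fun x => ((A x j * B x l : ℝ) : ℂ)) k := by
  have hκ : ∀ j l, Integrable (fun z : EuclideanSpace ℝ d =>
      ⟪oseenKernel σ z (EuclideanSpace.single j (1 : ℝ)) (EuclideanSpace.single l (1 : ℝ)), w⟫) :=
    fun j l => integrable_inner_oseenKernel_real hσ _ _ w
  have hAB : ∀ j l, Continuous fun x : UnitAddTorus d => A x j * B x l := fun j l =>
    ((EuclideanSpace.proj j).continuous.comp hA).mul ((EuclideanSpace.proj l).continuous.comp hB)
  -- rewrite the function
  have hfun : (fun x => ((⟪oseenSlice σ (Torus.lift A) (Torus.lift B) (Torus.repr x), w⟫ : ℝ) : ℂ)) =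
      fun x => ∑ j, ∑ l, ((∫ z : EuclideanSpace ℝ d,
        ⟪oseenKernel σ z (EuclideanSpace.single j (1 : ℝ)) (EuclideanSpace.single l (1 : ℝ)), w⟫ •
          (fun y => A y j * B y l) (x - Torus.proj z) : ℝ) : ℂ) := by
    funext x
    rw [inner_oseenSlice_lift_repr_eq_sum hA hB hσ w x]
    push_cast
    rfl
  rw [hfun]
  -- integrability of each smoothing (continuous on the compact torus)
  have hsm : ∀ j l, Integrable (fun x : UnitAddTorus d => ((∫ z : EuclideanSpace ℝ d,
      ⟪oseenKernel σ z (EuclideanSpace.single j (1 : ℝ)) (EuclideanSpace.single l (1 : ℝ)), w⟫ •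
        (fun y => A y j * B y l) (x - Torus.proj z) : ℝ) : ℂ)) volume := fun j l =>
    (Complex.continuous_ofReal.comp (Torus.continuous_integral_kernel_smul (hκ j l) (hAB j l))).integrable_unitAddTorus
  rw [Torus.mFourierCoeff_finset_sum _ (fun j _ => integrable_finsetSum _ (fun l _ => hsm j l))]
  refine Finset.sum_congr rfl fun j _ => ?_
  rw [Torus.mFourierCoeff_finset_sum _ (fun l _ => hsm j l)]
  refine Finset.sum_congr rfl fun l _ => ?_
  exact Torus.mFourierCoeff_ofReal_integral_kernel_smul (hκ j l) (hAB j l) k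

/-- **Bound of the torus Fourier coefficients of the paired slice**:
`|𝓕_𝕋(⟪N_σ[lift A, lift B] ∘ repr, w⟫)(k)| ≤ 2π |latticeVec k| ‖w‖ Σⱼₗ |𝓕_𝕋(AⱼBₗ)(k)|`, uniformly in
`σ > 0` (Koch–Tataru's symbol bound term by term). [cite: KochTataruAdvMath2001, §2 (6)–(8)] -/
theorem norm_mFourierCoeff_inner_oseenSlice_lift_repr_le {A B : UnitAddTorus d → EuclideanSpace ℝ d}
    (hA : Continuous A) (hB : Continuous B) {σ : ℝ} (hσ : 0 < σ) (w : EuclideanSpace ℝ d)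
    (k : d → ℤ) :
    ‖mFourierCoeff (fun x => ((⟪oseenSlice σ (Torus.lift A) (Torus.lift B) (Torus.repr x), w⟫ : ℝ) : ℂ)) k‖ ≤
      2 * π * ‖Torus.latticeVec k‖ * ‖w‖ *
        ∑ j, ∑ l, ‖mFourierCoeff (fun x => ((A x j * B x l : ℝ) : ℂ)) k‖ := by
  rw [mFourierCoeff_inner_oseenSlice_lift_repr hA hB hσ w k, Finset.mul_sum]
  refine (norm_sum_le _ _).trans (Finset.sum_le_sum fun j _ => ?_)
  rw [Finset.mul_sum]
  refine (norm_sum_le _ _).trans (Finset.sum_le_sum fun l _ => ?_)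
  rw [norm_mul]
  have h := norm_fourier_inner_oseenKernel_le hσ (EuclideanSpace.single j (1 : ℝ))
    (EuclideanSpace.single l (1 : ℝ)) w (Torus.latticeVec k)
  simp only [PiLp.norm_single, norm_one, mul_one] at h
  exact mul_le_mul_of_nonneg_right h (norm_nonneg _)

end Torus

end Literature.Analysis.FluidPDE
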